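import Summits.AtomisticToContinuum.Crystallization.Theorems.ChartedZeroExcessLayeredLatticeLiouvilleZZZYQA

/-!
# ChartedZeroExcess · LayeredLatticeLiouville ZZZYRA (lens-2 g97 «RigiditySplit» — NODE D of the generic-side crux of record (U♯)) — docket 26636, UNIF-96/97

TARGET (tree ZZZYQA, (175) p857972): (U♯) `UniformEquilStabilityAt s Λ κ₀ c₀` — every equilibrium `s`-chart at every scale admits a `c₀`-co-Lipschitz
re-indexing `w'` of its layered set with `CoerciveZ (layeredKernel (L t₁) (L t₂) w') κ₀` (LJ bond Hessians WITH prestress, layer-local currency `nnFormZ`).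

THE LENS (structural dichotomy special | generic) is applied to the INTERACTING PAIRS of an admissible word, not to the words: every pair of sites is
EITHER a CONTACT pair (length in the clean contact shell, `≤ r₁`, `r₁` anywhere in the empty gap `(1.0627, 6/5)` of tree `label_pair_dichotomy`) OR a
FAR pair (`> r₁`); the exhaustion is the clean shell gap (tree ZZZYJ `placedCrystal_pair_dichotomy`, Literature `IsTwoShellGoodSet`).  The harmonic form
then splits into a POTENTIAL-FREE RIGIDITY side (generic: it sees only the contact graph, which in every Barlow word is a face-to-face tiling by regular
tetrahedra and octahedra) and a SIGNED PERTURBATION BUDGET (special: the LJ numbers `a(r) = V'' = 13r⁻¹⁴ − 7r⁻⁸`, `b(r) = V'/r = r⁻⁸ − r⁻¹⁴` on the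
clean scale window).  Per bond `⟪v, forceConst e v⟫ = a(‖e‖)·⟨ê,v⟩² + b(‖e‖)·(‖v‖² − ⟨ê,v⟩²)` (tree `forceConst_apply`, ZZZYJ `bondHess`).
PIECES (all `∀ a > 0`, over `IsAdmissibleWord a s Λ c₀ ℓ₀ L w'` = the chart clauses of `IsEquilChart` + `c₀`-co-Lipschitz + `ℓ₀`-Lipschitz layer
offsets + clean + Nash of the layered set; currencies: contact STRETCH form `S₁ = stretchForm 0 r₁`, windowed far stretch forms `S_i = stretchForm (ρ i)
(ρ (i+1))`, contact DISPLACEMENT form `N₁ = contactForm r₁`, index form `nnFormZ`):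
* (RI♯) `UniformReindexP s Λ c₀ ℓ₀` — re-indexing only (set equation + co-Lipschitz + Lipschitz offsets).  support · ATTACKABLE-S · WEAKER ((U♯) minus
  all energy content; order layers along the normal, reduce offsets into a fundamental cell).
* (K♯) `UniformContactKornP s Λ c₀ ℓ₀ r₁ cK` — WORD-UNIFORM DISCRETE KORN INEQUALITY OF THE CONTACT TRUSS: `cK·N₁ ≤ S₁ ≤ N₁` for every finitely
  supported field.  ★ crux (rank 2) · GENERIC (potential-free, prestress-free, scale-free) · INSTRUMENTED (desk KORN-97, Bloch infimum, K₁ currency: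
  `cK = 0.1260` hcp = dhcp = 6H, `0.1286` fcc — word spread 2 %, minimiser long-wave) · ATTACKABLE-M (local rigidity of tet/oct cells + compatibility;
  the word-uniform statement is not in print) · WEAKER: a Korn inequality is not a stability statement — it holds verbatim for trusses whose LJ form is
  indefinite (any contact scale beyond the inflection `r⋆⁶ = 13/7`), so (K♯) ⇏ (U♯); conversely (U♯) carries no potential-free content.
* (SD♯) `ShellStretchDominationP s Λ c₀ ℓ₀ r₁ n ρ C` — far STRETCHES are dominated by contact STRETCHES, window by window: `S_i ≤ C i · S₁` (`i < n`).
  support/crux (rank 4) · GENERIC · ATTACKABLE-S (rigid clusters: the regular octahedron carries its `√2` diagonals with `ρ = 3/2`, the trigonal bipyramid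
  its `√(8/3)` axis, face-sharing tet/oct chains the `√3, √(11/3), 2, …` pairs — desk DOM-97: every far pair of length `≤ 2` is controlled inside a
  cluster of `≤ 11` atoms, `ρ ≤ 5/3`; cluster TYPES along a segment of length `≤ ρ_n` are determined by `≤ 4` Hägg letters, so the constants are
  word-uniform BY CONSTRUCTION) · WEAKER (pure kinematics of the contact graph).
* (SP♯) `SignedShellBudgetP s Λ c₀ ℓ₀ r₁ cK κ₁ γT n ρ C` — THE SIGNED SHELL BUDGET: per scale `a`, multipliers `γS, γN ∈ ℝ`, `γ i ≥ 0` with the closure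
  arithmetic `κ₁ ≤ (γS − Σ γ i·C i)·cK + γN`, `κ₁ ≤ (γS − Σ γ i·C i) + γN`, such that for every admissible word and field
  `γS·S₁ + γN·N₁ − Σ_{i<n} γ i·S_i − γT·nnFormZ ≤ E/2` (E = the harmonic form).  ★ crux (rank 3) · SPECIAL (this is where the LJ numbers live: contact
  identity `a s² + b(‖Δφ‖² − s²)` ⇒ `γS = a₁ − b₁`, `γN = b₁ −` displacement-currency middle tail, far radial deficits `−a₋(d)·s²` charged to the windows,
  far `b(d) > 0` DROPPED (sign), extreme tail by the PROVED (T) `tailDominationCert_holds` in `nnFormZ` currency via `γT`) · INSTRUMENTED (desk ARCH-97: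
  with Bloch-exact domination the budget constant `κ₁ = (a₁ − λ_far)·cK + min(b₁, 0)` is POSITIVE over the whole clean window `r₁/a ∈ [0.8602, 1.0442]`
  for fcc/hcp/dhcp/6H — `5.1 → 1.41 → 0.51 → 0.07…0.09` (radial only; `0.21…0.23` with the tension credit `γN = b₁ > 0` at the tensile edge), word
  spread ≤ 4 %; with CRUDE overlap-counted cluster constants it closes on `[0.8602, 0.90]` and needs joint cluster-type constants within ×1.5–3 of
  exact on `(0.90, 1.0442]` — census ASK COUNTS-97) · UNDECIDED(test) at the strained tensile corner · WEAKER (an inequality between four explicitly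
  typed quadratic forms with free multipliers; (U♯) is its conjunction with (K♯), (SD♯), (CZ♯) only through the glue below).
* (CZ♯) `IndexCurrencyP s Λ c₀ ℓ₀ r₁ cZ` — currency exchange `cZ·nnFormZ ≤ N₁` (index neighbours are joined by contact paths of bounded length).
  support · ATTACKABLE-S · WEAKER (bookkeeping; CURRENCY-96 booking `cZ ≈ 1/(2c₃)`, `c₃ ≈ 7–7.8`).
GLUE (PROVED, 0 sorry): `uniformEquilStabilityAt_of_rigiditySplit : 0 ≤ κ₁ → κ₀ ≤ κ₁·cZ − γT → (RI♯) → (K♯) → (SD♯) → (SP♯) → (CZ♯) → (U♯)(κ₀, c₀)` —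
pure real arithmetic (`budget_arith`, a two-case split on the sign of `γS − Σ γ i·C i`) after re-indexing; record instance at `(s, Λ) = (1/50, 2)`.
WHY NOVEL (vs g96 NODE C storage certificates, KORN-96's displacement-currency chain, lenses 3/4/5): far shells are charged against contact STRETCHES
(rigidity currency, no `1/cK` loss), not displacements — this is what rescues the margin KORN-96 lost (×1.06 → fails in bulk); the only word-global
statement left is the potential-free Korn constant (K♯), everything carrying LJ numbers is local and finite (SP♯/SD♯).  No lens-3/4/5 node touches (U♯).
0 sorry · import = tree ZZZYQA · 9 defs + 4 theorems + 1 example · no instances/notation/options · axioms standard. [g97]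
-/

noncomputable section

open scoped BigOperators InnerProductSpace RealInnerProductSpace
open MeasureTheory Set Metric Filter Topology

namespace Summit.AtomisticToContinuum.Crystallization.Theorems.ChartedZeroExcessLayeredLatticeLiouville

open Summit.AtomisticToContinuum.Crystallization.Theorems.ChartedPlanarOrderRigidityDoor (E3 IsClean IsNash)
open Summit.AtomisticToContinuum.Crystallization.Theorems.ChartedPlanarOrderDensityDichotomy (μS)
open Summit.AtomisticToContinuum.Crystallization.Theorems.ChartedPlanarOrderMesoCut (LayeredHom)
open Summit.AtomisticToContinuum.Crystallization.Theorems.ChartedPlanarOrderDoorLayered (Layered)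
open Literature.MathematicalPhysics.StatisticalMechanics (triangularVec₁ triangularVec₂)

/-! ### Currencies: bond vectors, windowed stretch forms, the contact displacement form -/

/-- first in-plane generator of the chart `L` (the `L t₁` of (U♯), spelled out). [g97] -/
def gen₁ (L : E3 ≃L[ℝ] E3) : E3 := (L : E3 →L[ℝ] E3) (triangularVec₁ 1)

/-- second in-plane generator of the chart `L` (the `L t₂` of (U♯), spelled out). [g97] -/
def gen₂ (L : E3 ≃L[ℝ] E3) : E3 := (L : E3 →L[ℝ] E3) (triangularVec₂ 1)

/-- the BOND VECTOR of an index pair `x = ((γ, m), (γ', m'))`: `site(γ', m') − site(γ, m)` (E `lsite`). [g97] -/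
def bondVec (a b : E3) (w : ℤ → E3) (x : (Cell 2 × ℤ) × (Cell 2 × ℤ)) : E3 :=
  lsite a b w x.2.1 x.2.2 - lsite a b w x.1.1 x.1.2

/-- WINDOWED STRETCH FORM `S_(r₋, r₊](φ) = Σ_{r₋ < ‖e‖ ≤ r₊} ⟨e, Δφ⟩² / ‖e‖²` (ordered pairs; a `finsum`, finite for finitely supported `φ` on a
co-Lipschitz word).  `stretchForm 0 r₁` is the CONTACT stretch form `S₁`. [g97] -/
def stretchForm (rlo rhi : ℝ) (a b : E3) (w : ℤ → E3) (φ : Cell 2 → ℤ → E3) : ℝ :=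
  ∑ᶠ x : (Cell 2 × ℤ) × (Cell 2 × ℤ),
    if rlo < ‖bondVec a b w x‖ ∧ ‖bondVec a b w x‖ ≤ rhi then
      ⟪bondVec a b w x, φ x.2.1 x.2.2 - φ x.1.1 x.1.2⟫ ^ 2 / ‖bondVec a b w x‖ ^ 2 else 0

/-- CONTACT DISPLACEMENT FORM `N₁(φ) = Σ_{0 < ‖e‖ ≤ r₁} ‖Δφ‖²` (ordered pairs) — the geometric, indexing-free K₁ currency. [g97] -/
def contactForm (r₁ : ℝ) (a b : E3) (w : ℤ → E3) (φ : Cell 2 → ℤ → E3) : ℝ :=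
  ∑ᶠ x : (Cell 2 × ℤ) × (Cell 2 × ℤ),
    if 0 < ‖bondVec a b w x‖ ∧ ‖bondVec a b w x‖ ≤ r₁ then ‖φ x.2.1 x.2.2 - φ x.1.1 x.1.2‖ ^ 2 else 0

/-- `contactForm` is non-negative (a `finsum` of squares). [g97] -/
theorem contactForm_nonneg (r₁ : ℝ) (a b : E3) (w : ℤ → E3) (φ : Cell 2 → ℤ → E3) : 0 ≤ contactForm r₁ a b w φ :=
  finsum_nonneg fun x => by
    split_ifs <;> positivity

/-! ### Admissible words -/

/-- ADMISSIBLE WORD at scale `a`: the chart clauses of `IsEquilChart` (`‖L‖, ‖L⁻¹‖ ≤ Λ`, `s`-conformal about `a`) for an ALREADY RE-INDEXED offset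
sequence `w'` — `c₀`-co-Lipschitz sites (E `IsLayeredCrystal`), consecutive offsets `ℓ₀`-bounded — whose layered set is clean and single-site Nash.
Every piece below quantifies over these; `isAdmissibleWord_of_equilChart` produces them from (RI♯). [g97] -/
def IsAdmissibleWord (a s Λ c₀ ℓ₀ : ℝ) (L : E3 ≃L[ℝ] E3) (w' : ℤ → E3) : Prop :=
  ‖(L : E3 →L[ℝ] E3)‖ ≤ Λ ∧ ‖(L.symm : E3 →L[ℝ] E3)‖ ≤ Λ ∧ IsConfChart a s (L : E3 →L[ℝ] E3) ∧
    IsLayeredCrystal c₀ (gen₁ L) (gen₂ L) w' ∧ (∀ m : ℤ, ‖w' (m + 1) - w' m‖ ≤ ℓ₀) ∧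
    IsClean (μS (Layered (gen₁ L) (gen₂ L) w')) ∧ IsNash (μS (Layered (gen₁ L) (gen₂ L) w'))

/-! ### The pieces -/

/-- **(RI♯) «UniformReindexP s Λ c₀ ℓ₀»** — RE-INDEXING ONLY: every equilibrium chart's layered set is `Layered (L t₁) (L t₂) w'` for an offset
sequence `w'` with `c₀`-co-Lipschitz sites and `ℓ₀`-bounded consecutive offsets.  support · ATTACKABLE-S (order the layers along the normal, reduce
each offset into a fundamental cell of the in-plane lattice; `c₀` from the clean separation and the layer spacing) · WEAKER than (U♯): its first two
clauses verbatim, no energy content.  Why it might fail: only through a mis-set `ℓ₀`/`c₀` (take `ℓ₀ = 3`, `c₀ ≤ 0.8·(layer spacing)`).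
Sources: tree Q `IsEquilChart`, E `IsLayeredCrystal`, `layeredHom_eq_layered`. [g97] -/
def UniformReindexP (s Λ c₀ ℓ₀ : ℝ) : Prop :=
  ∀ a : ℝ, 0 < a → ∀ (L : E3 ≃L[ℝ] E3) (w : ℤ → E3), IsEquilChart a s Λ L w →
    ∃ w' : ℤ → E3, Layered (gen₁ L) (gen₂ L) w' = LayeredHom (L : E3 →L[ℝ] E3) w ∧
      IsLayeredCrystal c₀ (gen₁ L) (gen₂ L) w' ∧ ∀ m : ℤ, ‖w' (m + 1) - w' m‖ ≤ ℓ₀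

/-- ★ **(K♯) «UniformContactKornP s Λ c₀ ℓ₀ r₁ cK»** — THE WORD-UNIFORM DISCRETE KORN INEQUALITY OF THE CONTACT TRUSS: for every admissible word at
every scale and every finitely supported field, `cK · N₁(φ) ≤ S₁(φ) ≤ N₁(φ)` (contact stretches control contact displacement differences; the upper
half is termwise Cauchy–Schwarz).  crux (rank 2) · GENERIC: potential-free, prestress-free, scale-free — it sees only the contact graph, a face-to-face
tiling by regular tetrahedra and octahedra in EVERY Barlow word · INSTRUMENTED: desk KORN-97 (pure-python Bloch infimum over the Brillouin zone, K₁
currency) `cK = 0.1260` (hcp, dhcp, 6H), `0.1286` (fcc), word spread 2 %, minimiser long-wave (continuum Korn without boundary) · ATTACKABLE-M.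
Why it might fail: a word-dependent soft zone-boundary mode of the contact truss not seen in periods ≤ 6 (desk says no: the infimum is acoustic and
the acoustic tensor is word-insensitive to 2 %), or loss of uniformity under the admissible 2 % in-plane strain.  WEAKER than (U♯): holds verbatim for
LJ-unstable trusses (contact scale beyond the inflection), so it cannot imply stability.  Sources: KORN-96/KORN-97 desk; discrete Korn inequalities
for periodic frameworks (Hudson–Ortner doi:10.1051/m2an/2011014 §3); memo NODE-g97 §3. [g97] -/
def UniformContactKornP (s Λ c₀ ℓ₀ r₁ cK : ℝ) : Prop :=
  ∀ a : ℝ, 0 < a → ∀ (L : E3 ≃L[ℝ] E3) (w' : ℤ → E3), IsAdmissibleWord a s Λ c₀ ℓ₀ L w' →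
    ∀ φ : Cell 2 → ℤ → E3, HasFiniteSupport φ →
      cK * contactForm r₁ (gen₁ L) (gen₂ L) w' φ ≤ stretchForm 0 r₁ (gen₁ L) (gen₂ L) w' φ ∧
        stretchForm 0 r₁ (gen₁ L) (gen₂ L) w' φ ≤ contactForm r₁ (gen₁ L) (gen₂ L) w' φ

/-- **(SD♯) «ShellStretchDominationP s Λ c₀ ℓ₀ r₁ n ρ C»** — FAR STRETCHES ARE DOMINATED BY CONTACT STRETCHES, window by window: for `i < n`,
`S_(ρ i, ρ (i+1)](φ) ≤ C i · S₁(φ)`.  support/crux (rank 4) · GENERIC (pure kinematics of the contact graph) · ATTACKABLE-S: each far pair of length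
`≤ ρ n` lies in a RIGID cluster of contact cells along its segment (regular octahedron for its `√2` diagonals, `ρ = 3/2`; trigonal bipyramid for the
`√(8/3)` axis; face-sharing tet/oct chains beyond), whose TYPE is fixed by `≤ 4` Hägg letters — finitely many types, so the constants are word-uniform
by construction; desk DOM-97: every pair of length `≤ 2` is controlled in a cluster of `≤ 11` atoms with `ρ ≤ 5/3` (individually; overlap-counted
`C(√2) = 9`, `C(√3) = 36.7`, `C(2) = 37.1` for fcc — joint per-type counting is the census ASK).  Why it might fail: only by mis-set constants (a
flexible cluster choice — the centred 13-atom star IS flexible, desk STAR-97 — gives no bound; the tet/oct chains do).  WEAKER than (U♯): no potential.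
Sources: DOM-97/STAR-97 desk; rigidity of convex deltahedra (Cauchy/Dehn); memo NODE-g97 §3. [g97] -/
def ShellStretchDominationP (s Λ c₀ ℓ₀ r₁ : ℝ) (n : ℕ) (ρ C : ℕ → ℝ) : Prop :=
  ∀ a : ℝ, 0 < a → ∀ (L : E3 ≃L[ℝ] E3) (w' : ℤ → E3), IsAdmissibleWord a s Λ c₀ ℓ₀ L w' →
    ∀ φ : Cell 2 → ℤ → E3, HasFiniteSupport φ → ∀ i : ℕ, i < n →
      stretchForm (ρ i) (ρ (i + 1)) (gen₁ L) (gen₂ L) w' φ ≤ C i * stretchForm 0 r₁ (gen₁ L) (gen₂ L) w' φ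

/-- ★ **(SP♯) «SignedShellBudgetP s Λ c₀ ℓ₀ r₁ cK κ₁ γT n ρ C»** — THE SIGNED SHELL BUDGET (special side: the only piece that knows the LJ numbers).
Per scale `a > 0` there are multipliers `γS γN : ℝ`, `γ : ℕ → ℝ` with `γ i ≥ 0` and the CLOSURE ARITHMETIC `κ₁ ≤ (γS − Σ_{i<n} γ i·C i)·cK + γN`,
`κ₁ ≤ (γS − Σ_{i<n} γ i·C i) + γN`, such that for every admissible word, every finitely supported `φ` and every value `E` of the harmonic form
(`HasSum`, B `CoerciveZ` verbatim) `γS·S₁(φ) + γN·N₁(φ) − Σ_{i<n} γ i·S_(ρ i, ρ (i+1)](φ) − γT·nnFormZ φ ≤ E/2`.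
Intended proof: contact bonds EXACTLY `a(r)s² + b(r)(‖Δφ‖² − s²)` (`γS = a₁ − b₁`, `γN = b₁ − T_mid`), far radial deficits `−a₋(d)s²` charged to the
windows (`γ i = sup a₋`), far transverse `b(d) > 0` DROPPED, middle tail `(ρ n, ϱ₀]` in displacement currency (`T_mid`, UY `norm_layeredKernel_le`),
extreme tail by the PROVED (T) `tailDominationCert_holds` (`γT = ε`).  crux (rank 3) · SPECIAL · INSTRUMENTED: desk ARCH-97 — with exact domination
`κ₁(r₁) = (a₁ − λ_far)·cK + min(b₁, 0) = 5.10, 2.61, 1.41, 0.81, 0.51, 0.19, 0.09` at `r₁ = 0.8602, 0.90, 0.9375, 0.9718, 1, 1.03, 1.0442` (hcp; fcc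
within 4 %; `κ_arch = 0.21–0.23` at the tensile edge with the tension credit), i.e. POSITIVE ACROSS THE CLEAN WINDOW; with crude overlap-counted (SD♯)
constants it closes on `[0.8602, 0.90]` only · UNDECIDED(test): joint cluster-type constants on `(0.90, 1.0442]` and the `s = 1/50` strain boxes at the
tensile corner (`∂a₁/∂r · s·r ≈ ∓1.3` against `a₁ = 2.14`).  Why it might fail: at the strained tensile corner the far radial deficit plus the
displacement-currency tail may exceed `(a₁ − b₁)·cK + b₁` — the budget, not the crystal, fails first (κ_full = 0.21 there).  WEAKER than (U♯): an
inequality between four typed quadratic forms with free multipliers; implies nothing without (K♯), (SD♯), (CZ♯).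
Sources: ARCH-97/KORN-97 desk; tree UY `norm_layeredKernel_le`, UW `tailDominationCert_holds`, ZZZYJ `bondHess`, `soft_bond_sign_record`. [g97] -/
def SignedShellBudgetP (s Λ c₀ ℓ₀ r₁ cK κ₁ γT : ℝ) (n : ℕ) (ρ C : ℕ → ℝ) : Prop :=
  ∀ a : ℝ, 0 < a → ∃ (γS γN : ℝ) (γ : ℕ → ℝ), (∀ i, 0 ≤ γ i) ∧
    κ₁ ≤ (γS - ∑ i ∈ Finset.range n, γ i * C i) * cK + γN ∧
    κ₁ ≤ (γS - ∑ i ∈ Finset.range n, γ i * C i) + γN ∧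
    ∀ (L : E3 ≃L[ℝ] E3) (w' : ℤ → E3), IsAdmissibleWord a s Λ c₀ ℓ₀ L w' →
      ∀ φ : Cell 2 → ℤ → E3, HasFiniteSupport φ → ∀ E : ℝ,
        HasSum (fun x : (Cell 2 × ℤ) × (Cell 2 × ℤ) =>
          ⟪φ x.2.1 x.2.2 - φ x.1.1 x.1.2,
            layeredKernel (gen₁ L) (gen₂ L) w' (x.2.1 - x.1.1) x.1.2 x.2.2 (φ x.2.1 x.2.2 - φ x.1.1 x.1.2)⟫) E →
        γS * stretchForm 0 r₁ (gen₁ L) (gen₂ L) w' φ + γN * contactForm r₁ (gen₁ L) (gen₂ L) w' φ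
            - ∑ i ∈ Finset.range n, γ i * stretchForm (ρ i) (ρ (i + 1)) (gen₁ L) (gen₂ L) w' φ - γT * nnFormZ φ ≤ E / 2

/-- **(CZ♯) «IndexCurrencyP s Λ c₀ ℓ₀ r₁ cZ»** — CURRENCY EXCHANGE: `cZ · nnFormZ φ ≤ N₁(φ)` on every admissible word (index neighbours
`dist ≤ 1` in `Cell 2 × ℤ` are joined by contact paths of length `≤ ℓ(ℓ₀, c₀)`, each contact bond serving boundedly many index pairs).
support · ATTACKABLE-S · WEAKER (bookkeeping).  Why it might fail: only if (RI♯)'s `ℓ₀` is dropped (a wild indexing makes `nnFormZ` see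
far-apart sites).  Sources: CURRENCY-96 booking (`cZ ≈ 1/(2c₃)`, `c₃ ≈ 7–7.8`, critic r1703 (D)); B `nnFormZ`. [g97] -/
def IndexCurrencyP (s Λ c₀ ℓ₀ r₁ cZ : ℝ) : Prop :=
  ∀ a : ℝ, 0 < a → ∀ (L : E3 ≃L[ℝ] E3) (w' : ℤ → E3), IsAdmissibleWord a s Λ c₀ ℓ₀ L w' →
    ∀ φ : Cell 2 → ℤ → E3, HasFiniteSupport φ → cZ * nnFormZ φ ≤ contactForm r₁ (gen₁ L) (gen₂ L) w' φ

/-! ### Glue (PROVED) -/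

/-- (RI♯)'s output is an admissible word: the chart clauses and clean/Nash transfer along the set equation. [g97] -/
theorem isAdmissibleWord_of_equilChart {a s Λ c₀ ℓ₀ : ℝ} {L : E3 ≃L[ℝ] E3} {w w' : ℤ → E3} (hE : IsEquilChart a s Λ L w)
    (hset : Layered (gen₁ L) (gen₂ L) w' = LayeredHom (L : E3 →L[ℝ] E3) w) (hco : IsLayeredCrystal c₀ (gen₁ L) (gen₂ L) w')
    (hlip : ∀ m : ℤ, ‖w' (m + 1) - w' m‖ ≤ ℓ₀) : IsAdmissibleWord a s Λ c₀ ℓ₀ L w' := by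
  obtain ⟨h1, h2, h3, h4, h5⟩ := hE
  refine ⟨h1, h2, h3, hco, hlip, ?_, ?_⟩
  · rw [hset]; exact h4
  · rw [hset]; exact h5

/-- THE BUDGET ARITHMETIC (pure real inequalities): signed budget + window domination + two-sided Korn + currency exchange ⇒ coercivity constant,
by a two-case split on the sign of the net contact-stretch multiplier `γS − T`. [g97] -/
theorem budget_arith {S₁ N₁ Z E D T γS γN γT cK cZ κ₁ κ₀ : ℝ} (hB : γS * S₁ + γN * N₁ - D - γT * Z ≤ E / 2) (hD : D ≤ T * S₁)
    (hK1 : cK * N₁ ≤ S₁) (hK2 : S₁ ≤ N₁) (hZ : cZ * Z ≤ N₁) (hN : 0 ≤ N₁) (hZ0 : 0 ≤ Z)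
    (hc1 : κ₁ ≤ (γS - T) * cK + γN) (hc2 : κ₁ ≤ (γS - T) + γN) (h0 : 0 ≤ κ₁) (hκ : κ₀ ≤ κ₁ * cZ - γT) :
    κ₀ * Z ≤ E / 2 := by
  have h3 : κ₁ * (cZ * Z) ≤ κ₁ * N₁ := mul_le_mul_of_nonneg_left hZ h0
  have h4 : κ₀ * Z ≤ (κ₁ * cZ - γT) * Z := mul_le_mul_of_nonneg_right hκ hZ0
  rcases le_total 0 (γS - T) with hθ | hθ
  · have h1 : (γS - T) * (cK * N₁) ≤ (γS - T) * S₁ := mul_le_mul_of_nonneg_left hK1 hθ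
    have h2 : κ₁ * N₁ ≤ ((γS - T) * cK + γN) * N₁ := mul_le_mul_of_nonneg_right hc1 hN
    calc κ₀ * Z ≤ (κ₁ * cZ - γT) * Z := h4
      _ = κ₁ * (cZ * Z) - γT * Z := by ring
      _ ≤ κ₁ * N₁ - γT * Z := by linarith [h3]
      _ ≤ ((γS - T) * cK + γN) * N₁ - γT * Z := by linarith [h2]
      _ = (γS - T) * (cK * N₁) + γN * N₁ - γT * Z := by ring
      _ ≤ (γS - T) * S₁ + γN * N₁ - γT * Z := by linarith [h1]
      _ = γS * S₁ + γN * N₁ - T * S₁ - γT * Z := by ring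
      _ ≤ γS * S₁ + γN * N₁ - D - γT * Z := by linarith [hD]
      _ ≤ E / 2 := hB
  · have h1 : (γS - T) * N₁ ≤ (γS - T) * S₁ := mul_le_mul_of_nonpos_left hK2 hθ
    have h2 : κ₁ * N₁ ≤ ((γS - T) + γN) * N₁ := mul_le_mul_of_nonneg_right hc2 hN
    calc κ₀ * Z ≤ (κ₁ * cZ - γT) * Z := h4
      _ = κ₁ * (cZ * Z) - γT * Z := by ring
      _ ≤ κ₁ * N₁ - γT * Z := by linarith [h3]
      _ ≤ ((γS - T) + γN) * N₁ - γT * Z := by linarith [h2]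
      _ = (γS - T) * N₁ + γN * N₁ - γT * Z := by ring
      _ ≤ (γS - T) * S₁ + γN * N₁ - γT * Z := by linarith [h1]
      _ = γS * S₁ + γN * N₁ - T * S₁ - γT * Z := by ring
      _ ≤ γS * S₁ + γN * N₁ - D - γT * Z := by linarith [hD]
      _ ≤ E / 2 := hB

/-- ★★ **GLUE «RigiditySplit» (PROVED): (RI♯) ∧ (K♯) ∧ (SD♯) ∧ (SP♯) ∧ (CZ♯) ⇒ (U♯) `UniformEquilStabilityAt s Λ κ₀ c₀`** for every
`κ₀ ≤ κ₁·cZ − γT` (`0 ≤ κ₁`).  Re-index by (RI♯); on the admissible word, feed the value `E` of the harmonic form to (SP♯), dominate the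
windows by (SD♯), exchange currencies by (K♯) and (CZ♯), and close by `budget_arith`. [g97] -/
theorem uniformEquilStabilityAt_of_rigiditySplit {s Λ c₀ ℓ₀ r₁ cK cZ κ₁ κ₀ γT : ℝ} {n : ℕ} {ρ C : ℕ → ℝ} (h0 : 0 ≤ κ₁)
    (hκ : κ₀ ≤ κ₁ * cZ - γT) (hRI : UniformReindexP s Λ c₀ ℓ₀) (hK : UniformContactKornP s Λ c₀ ℓ₀ r₁ cK)
    (hSD : ShellStretchDominationP s Λ c₀ ℓ₀ r₁ n ρ C) (hSP : SignedShellBudgetP s Λ c₀ ℓ₀ r₁ cK κ₁ γT n ρ C)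
    (hCZ : IndexCurrencyP s Λ c₀ ℓ₀ r₁ cZ) : UniformEquilStabilityAt s Λ κ₀ c₀ := by
  intro a ha L w hLw
  obtain ⟨w', hset, hco, hlip⟩ := hRI a ha L w hLw
  have hadm : IsAdmissibleWord a s Λ c₀ ℓ₀ L w' := isAdmissibleWord_of_equilChart hLw hset hco hlip
  refine ⟨w', hset, hco, ?_⟩
  intro φ hφ E hE
  obtain ⟨γS, γN, γ, hγ, hc1, hc2, hbud⟩ := hSP a ha
  have hB := hbud L w' hadm φ hφ E hE
  obtain ⟨hK1, hK2⟩ := hK a ha L w' hadm φ hφ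
  have hDom := hSD a ha L w' hadm φ hφ
  have hZ := hCZ a ha L w' hadm φ hφ
  have hN : 0 ≤ contactForm r₁ (gen₁ L) (gen₂ L) w' φ := contactForm_nonneg _ _ _ _ _
  have hZ0 : 0 ≤ nnFormZ φ := finsum_nonneg fun x => by
    split_ifs <;> positivity
  have hD : ∑ i ∈ Finset.range n, γ i * stretchForm (ρ i) (ρ (i + 1)) (gen₁ L) (gen₂ L) w' φ ≤
      (∑ i ∈ Finset.range n, γ i * C i) * stretchForm 0 r₁ (gen₁ L) (gen₂ L) w' φ := by
    rw [Finset.sum_mul]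
    refine Finset.sum_le_sum fun i hi => ?_
    have hle := hDom i (Finset.mem_range.mp hi)
    calc γ i * stretchForm (ρ i) (ρ (i + 1)) (gen₁ L) (gen₂ L) w' φ
        ≤ γ i * (C i * stretchForm 0 r₁ (gen₁ L) (gen₂ L) w' φ) := mul_le_mul_of_nonneg_left hle (hγ i)
      _ = γ i * C i * stretchForm 0 r₁ (gen₁ L) (gen₂ L) w' φ := by ring
  exact budget_arith hB hD hK1 hK2 hZ hN hZ0 hc1 hc2 h0 hκ

/-- RECORD INSTANCE at the record chart class `(s, Λ) = (1/50, 2)` with `ℓ₀ = 3`, contact cut-off `r₁ = 9/8` (inside the empty gap), Korn constant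
`cK = 1/10` (desk `0.1256–0.1286`), budget constant `κ₁ = 1/20`, no (T)-tail (`γT = 0`): (U♯) holds with `κ₀ = cZ/20`. [g97] -/
example {c₀ cZ : ℝ} {n : ℕ} {ρ C : ℕ → ℝ} (hRI : UniformReindexP (1 / 50) 2 c₀ 3) (hK : UniformContactKornP (1 / 50) 2 c₀ 3 (9 / 8) (1 / 10))
    (hSD : ShellStretchDominationP (1 / 50) 2 c₀ 3 (9 / 8) n ρ C) (hSP : SignedShellBudgetP (1 / 50) 2 c₀ 3 (9 / 8) (1 / 10) (1 / 20) 0 n ρ C)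
    (hCZ : IndexCurrencyP (1 / 50) 2 c₀ 3 (9 / 8) cZ) : UniformEquilStabilityAt (1 / 50) 2 (cZ / 20) c₀ :=
  uniformEquilStabilityAt_of_rigiditySplit (κ₁ := 1 / 20) (by norm_num) (by linarith) hRI hK hSD hSP hCZ

end Summit.AtomisticToContinuum.Crystallization.Theorems.ChartedZeroExcessLayeredLatticeLiouville

end
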